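import Mathlib
import HarnessLib
import Summits.ABC.ABC.Theses.DefiniteXi

/-!
# Line `Sketch` — proof skeleton for the crux `SteinbergCore` (stmt-ABC-15024)

Card `steinberg-linvariant-slice` (crux-ideate k = 1, round 1; tree `Cruxes/SteinbergCore/SketchIdeator1.lean`),
reshaped by the line lead (prover-line-stmt-ABC-15024-0, 2026-08-16) into a registered skeleton:

* the crux `cps ξ(E;N/Nm,Nm) · ∏_{q ∣ N} v_q(Δ_min) ≤ C_ε N^(2+ε)` (`cps n = n / (2^{v₂ n} 3^{v₃ n})`) is cut
  along the quarantined primes `ℓ ∣ Nm, ℓ ≥ 5` ("on-level") versus the rest: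
  `cps ξ = on · (cps ξ / on)`, `on := ∏_{ℓ ∣ Nm, ℓ ≥ 5} ℓ^{v_ℓ ξ}` (exact: distinct primes ≥ 5 dividing `cps ξ`);
* `stub_sliceExcess` (the card's NEW content, "L-invariant rigidity"): `on ≤ C_ε N^ε · cap`, where
  `cap := ∏_{ℓ ∣ Nm, ℓ ≥ 5} ℓ^{min(v_ℓ ξ, v_ℓ(c_ℓ) + W_ℓ + 1)}` is the explicit ledger
  (`c_ℓ = v_ℓ(Δ_min)`, `W_ℓ` the Wieferich depth of the Tate unit of `E_(a,b)` at `ℓ`; NO cap at `ℓ` in the degenerate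
  case `x'^{ℓ-1} = (16y)^{ℓ-1}` where `W_ℓ = +∞` — reshaped after wave 1);
* `stub_ledgerCore` (the card's RESIDUAL; implied by the crux — `ledgerCore_of_steinbergCore` below — hence
  crux-sized by construction): `(cps ξ / on) · cap · ∏_{q ∣ N} v_q(Δ_min) ≤ C_ε N^(2+ε)`.

Both stubs are stated over tree vocabulary only (`brandtXi`, `freyCurve`, `LFunction`, `conductorNorm`,
`minimalDiscriminantNorm`, `Nat.factorization`, `padicValNat`, `padicValInt`), so that a landed stub file can state
them verbatim.  The composition `SteinbergCore_of` goes through the GENERAL ledger glue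
`core_of_ledgerSplit` (arbitrary on-level selector `on ∣ cps ξ` and arbitrary cap), which is the part
landed under `Theorems/` as a `--supports` helper; the converse `ledgerSplit_of_steinbergCore` records that the
residual stub is implied by the crux for every cap `≤ on`.

Composition (sorry-free apart from the two stubs): `SteinbergCore_of`.
-/

-- `Summit.<Summit>.<Problem>` is the mandated summit-side namespace (CONVENTIONS §2); for the single-conjunct
-- summit `ABC` the two coincide, so the duplicate `ABC.ABC` is deliberate.
set_option linter.dupNamespace false

namespace Summit.ABC.ABC.Cruxes.SteinbergCore.Sketch

open Literature.NumberTheory.EllipticCurves Literature.NumberTheory.Automorphic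

noncomputable section

/-! ### The two registered stubs (self-contained statements over tree vocabulary) -/

/-- **Stub 1 — SliceExcess** (card `steinberg-linvariant-slice`, the new content).  For every admissible
quarantine `Nm` the on-level part `∏_{ℓ ∣ Nm, ℓ ≥ 5} ℓ^{v_ℓ ξ}` of `ξ = brandtXi (N/Nm) Nm (a_n(E_(a,b)))` exceeds
the explicit ledger `∏_{ℓ ∣ Nm, ℓ ≥ 5} ℓ^{min(v_ℓ ξ, v_ℓ(v_ℓ Δ_min) + W_ℓ + 1)}` by a total factor `≤ C_ε N^ε`, where
`W_ℓ = v_ℓ(x'^{ℓ-1} − (16 y)^{ℓ-1}) − 1`, `x` the member of `(a, b, a+b)` divisible by `ℓ`, `x'` its `ℓ`-free part,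
`y` another member (the Wieferich depth of the Tate unit). OPEN (conjectural L-invariant rigidity). -/
theorem stub_sliceExcess :
    ∀ ε : ℝ, 0 < ε → ∃ C : ℝ, ∀ a b : ℤ, IsCoprime a b → a * b * (a + b) ≠ 0 →
      ∀ (N : ℕ) [NeZero N], (freyCurve a b).conductorNorm ℤ = N →
      ∀ Nm : ℕ, Odd Nm → Squarefree Nm → Odd Nm.primeFactors.card → Nm ∣ N →
        ((∏ ℓ ∈ Nm.primeFactors.filter (5 ≤ ·),
            ordProj[ℓ] (brandtXi (N / Nm) Nm (fun n => (freyCurve a b).LFunction n)) : ℕ) : ℝ) ≤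
          C * (N : ℝ) ^ ε *
            ((∏ ℓ ∈ Nm.primeFactors.filter (5 ≤ ·),
                ℓ ^ (if (((ordCompl[ℓ] (if (ℓ : ℤ) ∣ a then a.natAbs else if (ℓ : ℤ) ∣ b then b.natAbs
                              else (a + b).natAbs) : ℕ) : ℤ) ^ (ℓ - 1) =
                          ((16 * (if (ℓ : ℤ) ∣ a then b.natAbs else a.natAbs) : ℕ) : ℤ) ^ (ℓ - 1))
                    then (brandtXi (N / Nm) Nm (fun n => (freyCurve a b).LFunction n)).factorization ℓ
                    else min ((brandtXi (N / Nm) Nm (fun n => (freyCurve a b).LFunction n)).factorization ℓ)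
                      (padicValNat ℓ (((freyCurve a b).minimalDiscriminantNorm ℤ).factorization ℓ) +
                        (padicValInt ℓ
                            (((ordCompl[ℓ] (if (ℓ : ℤ) ∣ a then a.natAbs else if (ℓ : ℤ) ∣ b then b.natAbs
                                  else (a + b).natAbs) : ℕ) : ℤ) ^ (ℓ - 1) -
                              ((16 * (if (ℓ : ℤ) ∣ a then b.natAbs else a.natAbs) : ℕ) : ℤ) ^ (ℓ - 1)) - 1) +
                        1)) : ℕ) : ℝ) := by
  sorry

/-- **Stub 2 — LedgerCore** (card `steinberg-linvariant-slice`, the residual; IMPLIED BY the crux, see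
`ledgerCore_of_steinbergCore`, hence abc-strength by construction).  `SteinbergCore` with the on-level depths of
`ξ` at the quarantined primes `ℓ ≥ 5` replaced by their ledger-capped values:
`(cps ξ / on) · cap · ∏_{q ∣ N} v_q(Δ_min) ≤ C_ε N^(2+ε)`. OPEN. -/
theorem stub_ledgerCore :
    ∀ ε : ℝ, 0 < ε → ∃ C : ℝ, ∀ a b : ℤ, IsCoprime a b → a * b * (a + b) ≠ 0 →
      ∀ (N : ℕ) [NeZero N], (freyCurve a b).conductorNorm ℤ = N →
      ∀ Nm : ℕ, Odd Nm → Squarefree Nm → Odd Nm.primeFactors.card → Nm ∣ N →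
        ((brandtXi (N / Nm) Nm (fun n => (freyCurve a b).LFunction n) /
                (ordProj[2] (brandtXi (N / Nm) Nm (fun n => (freyCurve a b).LFunction n)) *
                  ordProj[3] (brandtXi (N / Nm) Nm (fun n => (freyCurve a b).LFunction n))) /
              ∏ ℓ ∈ Nm.primeFactors.filter (5 ≤ ·),
                ordProj[ℓ] (brandtXi (N / Nm) Nm (fun n => (freyCurve a b).LFunction n)) : ℕ) : ℝ) *
            ((∏ ℓ ∈ Nm.primeFactors.filter (5 ≤ ·),
                ℓ ^ (if (((ordCompl[ℓ] (if (ℓ : ℤ) ∣ a then a.natAbs else if (ℓ : ℤ) ∣ b then b.natAbs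
                              else (a + b).natAbs) : ℕ) : ℤ) ^ (ℓ - 1) =
                          ((16 * (if (ℓ : ℤ) ∣ a then b.natAbs else a.natAbs) : ℕ) : ℤ) ^ (ℓ - 1))
                    then (brandtXi (N / Nm) Nm (fun n => (freyCurve a b).LFunction n)).factorization ℓ
                    else min ((brandtXi (N / Nm) Nm (fun n => (freyCurve a b).LFunction n)).factorization ℓ)
                      (padicValNat ℓ (((freyCurve a b).minimalDiscriminantNorm ℤ).factorization ℓ) +
                        (padicValInt ℓ
                            (((ordCompl[ℓ] (if (ℓ : ℤ) ∣ a then a.natAbs else if (ℓ : ℤ) ∣ b then b.natAbs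
                                  else (a + b).natAbs) : ℕ) : ℤ) ^ (ℓ - 1) -
                              ((16 * (if (ℓ : ℤ) ∣ a then b.natAbs else a.natAbs) : ℕ) : ℤ) ^ (ℓ - 1)) - 1) +
                        1)) : ℕ) : ℝ) *
            ((∏ q ∈ N.primeFactors, ((freyCurve a b).minimalDiscriminantNorm ℤ).factorization q : ℕ) : ℝ) ≤
          C * (N : ℝ) ^ (2 + ε) := by
  sorry

/-! ### Local vocabulary (used only inside the composition; NOT inside stub signatures) -/

/-- `ξ(E_(a,b); N/Nm, Nm)`. -/
def xiFrey (a b : ℤ) (N Nm : ℕ) : ℕ :=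
  brandtXi (N / Nm) Nm (fun n => (freyCurve a b).LFunction n)

/-- The part of `n` prime to `6` (`0` for `n = 0`), written as in the route decl. -/
def cps (n : ℕ) : ℕ := n / (ordProj[2] n * ordProj[3] n)

/-- The full exponent product `∏_{q ∣ N} v_q(Δ_min(E_(a,b)))`. -/
def tamProd (a b : ℤ) (N : ℕ) : ℕ :=
  ∏ q ∈ N.primeFactors, ((freyCurve a b).minimalDiscriminantNorm ℤ).factorization q

/-- Quarantined primes `≥ 5`. -/
def onLevelPrimes (Nm : ℕ) : Finset ℕ := Nm.primeFactors.filter (5 ≤ ·)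

/-- Wieferich depth of the Tate unit of `E_(a,b)` at `ℓ` (the card's `W_ℓ`). -/
def tateWieferichDepth (ℓ : ℕ) (a b : ℤ) : ℕ :=
  padicValInt ℓ
      (((ordCompl[ℓ] (if (ℓ : ℤ) ∣ a then a.natAbs else if (ℓ : ℤ) ∣ b then b.natAbs
            else (a + b).natAbs) : ℕ) : ℤ) ^ (ℓ - 1) -
        ((16 * (if (ℓ : ℤ) ∣ a then b.natAbs else a.natAbs) : ℕ) : ℤ) ^ (ℓ - 1)) - 1

/-- The ledger exponent `v_ℓ(c_ℓ) + W_ℓ + 1`. -/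
def ledgerExp (a b : ℤ) (ℓ : ℕ) : ℕ :=
  padicValNat ℓ (((freyCurve a b).minimalDiscriminantNorm ℤ).factorization ℓ) + tateWieferichDepth ℓ a b + 1

/-- The capped exponent at `ℓ` for on-level depth `v = v_ℓ ξ`: `v` itself (NO cap) in the degenerate case
`x'^{ℓ-1} = (16 y)^{ℓ-1}` of the Tate-unit leading term (thin families `{±1, ±16 ℓ^k}`, where the card's
`W_ℓ` is `+∞`; reshaped after wave 1, worker note 3), and `min(v, ledgerExp)` otherwise. -/
def cappedExp (a b : ℤ) (ℓ v : ℕ) : ℕ :=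
  if ((ordCompl[ℓ] (if (ℓ : ℤ) ∣ a then a.natAbs else if (ℓ : ℤ) ∣ b then b.natAbs
          else (a + b).natAbs) : ℕ) : ℤ) ^ (ℓ - 1) =
      ((16 * (if (ℓ : ℤ) ∣ a then b.natAbs else a.natAbs) : ℕ) : ℤ) ^ (ℓ - 1)
  then v else min v (ledgerExp a b ℓ)

theorem cappedExp_le (a b : ℤ) (ℓ v : ℕ) : cappedExp a b ℓ v ≤ v := by
  unfold cappedExp
  split_ifs <;> first | exact le_rfl | exact min_le_left _ _

/-- On-level part of `ξ`: `∏_{ℓ ∣ Nm, ℓ ≥ 5} ℓ^{v_ℓ ξ}`. -/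
def onLevel (a b : ℤ) (N Nm : ℕ) : ℕ := ∏ ℓ ∈ onLevelPrimes Nm, ordProj[ℓ] (xiFrey a b N Nm)

/-- Ledger-capped on-level part: `∏_{ℓ ∣ Nm, ℓ ≥ 5} ℓ^{cappedExp}` (`= ℓ^{min(v_ℓ ξ, ledgerExp)}` off the
degenerate case). -/
def capped (a b : ℤ) (N Nm : ℕ) : ℕ :=
  ∏ ℓ ∈ onLevelPrimes Nm, ℓ ^ cappedExp a b ℓ ((xiFrey a b N Nm).factorization ℓ)

/-! ### Arithmetic of the split -/

theorem prime_of_mem_onLevelPrimes {Nm ℓ : ℕ} (h : ℓ ∈ onLevelPrimes Nm) : ℓ.Prime :=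
  Nat.prime_of_mem_primeFactors (Finset.mem_filter.mp h).1

theorem five_le_of_mem_onLevelPrimes {Nm ℓ : ℕ} (h : ℓ ∈ onLevelPrimes Nm) : 5 ≤ ℓ :=
  (Finset.mem_filter.mp h).2

/-- `∏_{ℓ ∈ S} ℓ^{v_ℓ ξ} ∣ ξ` for any finset `S` (terms off the support are `1`). -/
theorem prod_ordProj_dvd (ξ : ℕ) (S : Finset ℕ) : ∏ ℓ ∈ S, ordProj[ℓ] ξ ∣ ξ := by
  rcases Nat.eq_zero_or_pos ξ with h0 | hpos
  · subst h0; exact dvd_zero _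
  · have hself : ∏ p ∈ ξ.primeFactors, ordProj[p] ξ = ξ := by
      conv_rhs => rw [← Nat.prod_factorization_pow_eq_self hpos.ne']
      rw [Finsupp.prod, Nat.support_factorization]
    have hoff : ∀ x ∈ S, x ∉ S ∩ ξ.primeFactors → ordProj[x] ξ = 1 := by
      intro x hxS hxnot
      have hx : x ∉ ξ.primeFactors := fun h => hxnot (Finset.mem_inter.mpr ⟨hxS, h⟩)
      have : ξ.factorization x = 0 := by
        by_contra hne
        exact hx (by rw [← Nat.support_factorization]; exact Finsupp.mem_support_iff.mpr hne)
      simp [this]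
    calc ∏ ℓ ∈ S, ordProj[ℓ] ξ = ∏ ℓ ∈ S ∩ ξ.primeFactors, ordProj[ℓ] ξ :=
          (Finset.prod_subset Finset.inter_subset_left hoff).symm
      _ ∣ ∏ p ∈ ξ.primeFactors, ordProj[p] ξ :=
          Finset.prod_dvd_prod_of_subset _ _ _ Finset.inter_subset_right
      _ = ξ := hself

/-- `∏_{ℓ ∈ S} ℓ^{v_ℓ ξ} ∣ cps ξ` for a finset `S` avoiding `2` and `3`. -/
theorem prod_ordProj_dvd_cps (ξ : ℕ) (S : Finset ℕ) (h2 : 2 ∉ S) (h3 : 3 ∉ S) :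
    ∏ ℓ ∈ S, ordProj[ℓ] ξ ∣ cps ξ := by
  unfold cps
  rcases Nat.eq_zero_or_pos ξ with h0 | hpos
  · subst h0; simp
  · apply Nat.dvd_div_of_mul_dvd
    have h2' : (2 : ℕ) ∉ insert 3 S := by
      rw [Finset.mem_insert]
      rintro (h | h)
      · norm_num at h
      · exact h2 h
    have key := prod_ordProj_dvd ξ (insert 2 (insert 3 S))
    rw [Finset.prod_insert h2', Finset.prod_insert h3, ← mul_assoc] at key
    exact key

theorem onLevel_dvd_cps (a b : ℤ) (N Nm : ℕ) : onLevel a b N Nm ∣ cps (xiFrey a b N Nm) :=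
  prod_ordProj_dvd_cps _ _
    (fun h => by have := five_le_of_mem_onLevelPrimes h; omega)
    (fun h => by have := five_le_of_mem_onLevelPrimes h; omega)

theorem capped_le_onLevel (a b : ℤ) (N Nm : ℕ) : capped a b N Nm ≤ onLevel a b N Nm := by
  unfold capped onLevel
  exact Finset.prod_le_prod' fun ℓ hℓ =>
    Nat.pow_le_pow_right (prime_of_mem_onLevelPrimes hℓ).pos (cappedExp_le _ _ _ _)

/-! ### The general ledger glue (def-free form landed under `Theorems/` as a `--supports` helper) -/

/-- **General ledger glue.** For ANY on-level selector `on a b N Nm ∣ cps ξ` and ANY cap: if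
`on ≤ C_ε N^ε · cap` (slice excess) and `(cps ξ / on) · cap · ∏_{q∣N} v_q ≤ C_ε N^(2+ε)` (ledger core) at every
admissible datum, then the BODY of `SteinbergCore` holds (stated over the local vocabulary; `SteinbergCore_of`
below is the by-name form). Pure algebra on the pattern of `DefiniteXi.closes`, Step 1. -/
theorem core_of_ledgerSplit (on cap : ℤ → ℤ → ℕ → ℕ → ℕ)
    (hdvd : ∀ a b N Nm, on a b N Nm ∣ cps (xiFrey a b N Nm))
    (hS : ∀ ε : ℝ, 0 < ε → ∃ C : ℝ, ∀ a b : ℤ, IsCoprime a b → a * b * (a + b) ≠ 0 →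
      ∀ (N : ℕ) [NeZero N], (freyCurve a b).conductorNorm ℤ = N →
      ∀ Nm : ℕ, Odd Nm → Squarefree Nm → Odd Nm.primeFactors.card → Nm ∣ N →
        ((on a b N Nm : ℕ) : ℝ) ≤ C * (N : ℝ) ^ ε * ((cap a b N Nm : ℕ) : ℝ))
    (hL : ∀ ε : ℝ, 0 < ε → ∃ C : ℝ, ∀ a b : ℤ, IsCoprime a b → a * b * (a + b) ≠ 0 →
      ∀ (N : ℕ) [NeZero N], (freyCurve a b).conductorNorm ℤ = N →
      ∀ Nm : ℕ, Odd Nm → Squarefree Nm → Odd Nm.primeFactors.card → Nm ∣ N →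
        ((cps (xiFrey a b N Nm) / on a b N Nm : ℕ) : ℝ) * ((cap a b N Nm : ℕ) : ℝ) *
            ((tamProd a b N : ℕ) : ℝ) ≤ C * (N : ℝ) ^ (2 + ε)) :
    ∀ ε : ℝ, 0 < ε → ∃ C : ℝ, ∀ a b : ℤ, IsCoprime a b → a * b * (a + b) ≠ 0 →
      ∀ (N : ℕ) [NeZero N], (freyCurve a b).conductorNorm ℤ = N →
      ∀ Nm : ℕ, Odd Nm → Squarefree Nm → Odd Nm.primeFactors.card → Nm ∣ N →
        ((cps (xiFrey a b N Nm) : ℕ) : ℝ) * ((tamProd a b N : ℕ) : ℝ) ≤ C * (N : ℝ) ^ (2 + ε) := by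
  intro ε hε
  obtain ⟨C₁, hC₁⟩ := hS (ε / 2) (by linarith)
  obtain ⟨C₂, hC₂⟩ := hL (ε / 2) (by linarith)
  refine ⟨max C₁ 0 * max C₂ 0, ?_⟩
  intro a b hab h0 N _ hN Nm hodd hsq hcard hdv
  have hA' := hC₁ a b hab h0 N hN Nm hodd hsq hcard hdv
  have hB' := hC₂ a b hab h0 N hN Nm hodd hsq hcard hdv
  set ξ : ℕ := xiFrey a b N Nm with hξ
  set d : ℕ := on a b N Nm with hd
  set e : ℕ := cap a b N Nm with he
  set P : ℕ := tamProd a b N with hP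
  have hNpos : (0 : ℝ) < (N : ℝ) := by exact_mod_cast Nat.pos_of_ne_zero (NeZero.ne N)
  have hsplit : ((cps ξ : ℕ) : ℝ) = (d : ℝ) * ((cps ξ / d : ℕ) : ℝ) := by
    have : d * (cps ξ / d) = cps ξ := Nat.mul_div_cancel' (hdvd a b N Nm)
    exact_mod_cast this.symm
  have hc : (0 : ℝ) ≤ ((cps ξ / d : ℕ) : ℝ) := by positivity
  have hPnn : (0 : ℝ) ≤ (P : ℝ) := by positivity
  have henn : (0 : ℝ) ≤ (e : ℝ) := by positivity
  have hrpow1 : (0 : ℝ) ≤ (N : ℝ) ^ (ε / 2) := Real.rpow_nonneg hNpos.le _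
  have hrpow2 : (0 : ℝ) ≤ (N : ℝ) ^ (2 + ε / 2) := Real.rpow_nonneg hNpos.le _
  have hC₁0 : (0 : ℝ) ≤ max C₁ 0 := le_max_right _ _
  have hC₂0 : (0 : ℝ) ≤ max C₂ 0 := le_max_right _ _
  have hA'' : (d : ℝ) ≤ max C₁ 0 * (N : ℝ) ^ (ε / 2) * (e : ℝ) :=
    hA'.trans (by gcongr; exact le_max_left _ _)
  have hB'' : ((cps ξ / d : ℕ) : ℝ) * (e : ℝ) * (P : ℝ) ≤ max C₂ 0 * (N : ℝ) ^ (2 + ε / 2) :=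
    hB'.trans (by gcongr; exact le_max_left _ _)
  have hNsplit : (N : ℝ) ^ (ε / 2) * (N : ℝ) ^ (2 + ε / 2) = (N : ℝ) ^ (2 + ε) := by
    rw [← Real.rpow_add hNpos]; ring_nf
  calc ((cps ξ : ℕ) : ℝ) * (P : ℝ)
      = (d : ℝ) * (((cps ξ / d : ℕ) : ℝ) * (P : ℝ)) := by rw [hsplit]; ring
    _ ≤ (max C₁ 0 * (N : ℝ) ^ (ε / 2) * (e : ℝ)) * (((cps ξ / d : ℕ) : ℝ) * (P : ℝ)) := by gcongr
    _ = max C₁ 0 * (N : ℝ) ^ (ε / 2) * (((cps ξ / d : ℕ) : ℝ) * (e : ℝ) * (P : ℝ)) := by ring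
    _ ≤ max C₁ 0 * (N : ℝ) ^ (ε / 2) * (max C₂ 0 * (N : ℝ) ^ (2 + ε / 2)) := by gcongr
    _ = max C₁ 0 * max C₂ 0 * (N : ℝ) ^ (2 + ε) := by rw [← hNsplit]; ring

/-- **Converse bookkeeping.** For any selector `on ∣ cps ξ` and any cap with `cap ≤ on` pointwise, the crux
implies the ledger core — so `stub_ledgerCore` is implied by `SteinbergCore` (it is crux-sized by construction,
exactly as the card says). -/
theorem ledgerSplit_of_steinbergCore (on cap : ℤ → ℤ → ℕ → ℕ → ℕ)
    (hdvd : ∀ a b N Nm, on a b N Nm ∣ cps (xiFrey a b N Nm))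
    (hle : ∀ a b N Nm, cap a b N Nm ≤ on a b N Nm)
    (hSC : Summit.ABC.ABC.Theses.DefiniteXi.SteinbergCore) :
    ∀ ε : ℝ, 0 < ε → ∃ C : ℝ, ∀ a b : ℤ, IsCoprime a b → a * b * (a + b) ≠ 0 →
      ∀ (N : ℕ) [NeZero N], (freyCurve a b).conductorNorm ℤ = N →
      ∀ Nm : ℕ, Odd Nm → Squarefree Nm → Odd Nm.primeFactors.card → Nm ∣ N →
        ((cps (xiFrey a b N Nm) / on a b N Nm : ℕ) : ℝ) * ((cap a b N Nm : ℕ) : ℝ) *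
            ((tamProd a b N : ℕ) : ℝ) ≤ C * (N : ℝ) ^ (2 + ε) := by
  intro ε hε
  obtain ⟨C, hC⟩ := hSC ε hε
  refine ⟨C, ?_⟩
  intro a b hab h0 N _ hN Nm hodd hsq hcard hdv
  have h := hC a b hab h0 N hN Nm hodd hsq hcard hdv
  change ((cps (xiFrey a b N Nm) : ℕ) : ℝ) * ((tamProd a b N : ℕ) : ℝ) ≤ _ at h
  set ξ : ℕ := xiFrey a b N Nm with hξ
  have hmain : ((cps ξ / on a b N Nm : ℕ) : ℝ) * ((cap a b N Nm : ℕ) : ℝ) ≤ ((cps ξ : ℕ) : ℝ) := by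
    have : (cps ξ / on a b N Nm) * cap a b N Nm ≤ cps ξ :=
      calc (cps ξ / on a b N Nm) * cap a b N Nm ≤ (cps ξ / on a b N Nm) * on a b N Nm :=
            Nat.mul_le_mul_left _ (hle a b N Nm)
        _ = cps ξ := Nat.div_mul_cancel (hdvd a b N Nm)
    exact_mod_cast this
  have hPnn : (0 : ℝ) ≤ ((tamProd a b N : ℕ) : ℝ) := by positivity
  calc ((cps ξ / on a b N Nm : ℕ) : ℝ) * ((cap a b N Nm : ℕ) : ℝ) * ((tamProd a b N : ℕ) : ℝ)
      ≤ ((cps ξ : ℕ) : ℝ) * ((tamProd a b N : ℕ) : ℝ) := by gcongr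
    _ ≤ C * (N : ℝ) ^ (2 + ε) := h

/-! ### Composition -/

/-- **The crux, modulo the two stubs** (`stub_sliceExcess`, `stub_ledgerCore`). -/
theorem SteinbergCore_of : Summit.ABC.ABC.Theses.DefiniteXi.SteinbergCore := by
  intro ε hε
  exact core_of_ledgerSplit onLevel capped onLevel_dvd_cps
    (fun ε hε => stub_sliceExcess ε hε) (fun ε hε => stub_ledgerCore ε hε) ε hε

/-- The residual stub is implied by the crux (crux-sized by construction). -/
theorem ledgerCore_of_steinbergCore (hSC : Summit.ABC.ABC.Theses.DefiniteXi.SteinbergCore) :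
    ∀ ε : ℝ, 0 < ε → ∃ C : ℝ, ∀ a b : ℤ, IsCoprime a b → a * b * (a + b) ≠ 0 →
      ∀ (N : ℕ) [NeZero N], (freyCurve a b).conductorNorm ℤ = N →
      ∀ Nm : ℕ, Odd Nm → Squarefree Nm → Odd Nm.primeFactors.card → Nm ∣ N →
        ((cps (xiFrey a b N Nm) / onLevel a b N Nm : ℕ) : ℝ) * ((capped a b N Nm : ℕ) : ℝ) *
            ((tamProd a b N : ℕ) : ℝ) ≤ C * (N : ℝ) ^ (2 + ε) :=
  ledgerSplit_of_steinbergCore onLevel capped onLevel_dvd_cps capped_le_onLevel hSC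

end

end Summit.ABC.ABC.Cruxes.SteinbergCore.Sketch
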